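import Summits.HodgeConjecture.HodgeConjecture.Theorems.WeilTypeLadderTwistEigenCalculus
import Literature.AlgebraicGeometry.HodgeTheory.RealMultiplicationDivisorClasses
import Literature.AlgebraicGeometry.HodgeTheory.AbelianVarietyHodgeHomFullness
import Literature.AlgebraicGeometry.HodgeTheory.DivisorClassesHardLefschetz
import Literature.Algebra.Lie.KillingBaseChange
import HarnessLib

/-!
# Weil-type ladder — divisor classes from a polarization form and an endomorphism (Casimir classes on `H¹`)

b2b cell `hweil` (packet `run/shared/lean/b2b/hodge-weil/`), prover 3, kernel companion of THEOREM EXC of the report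
`b2b-hweil-pv3-g46/COMPACT-PAIRS.md` §7 (the seven Rohde-exceptional composite four-point families): the LINEAR
ALGEBRA on `H¹(B(ℂ); ℂ)` of a complex abelian variety `B` that produces RATIONAL `(1,1)`-classes out of a
non-degenerate `ℚ`-bilinear form `ψ` on `H¹(B(ℂ); ℚ)` which is isotropic on `H^{1,0}` and on `H^{0,1}` (the first
Riemann bilinear relation of a polarization) and an endomorphism `g : B ⟶ B`:

* `casimirSum_isRationalClass_and_isOfHodgeType` — for EVERY basis `b` of `H¹(B(ℂ); ℂ)` with `Ψ`-dual basis `d`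
  (`Ψ = ψ ⊗ ℂ` transported to `H¹(B(ℂ); ℂ)`), the class `Λ_b(g) = Σ_j g^*(d_j) ⌣ b_j ∈ H²(B(ℂ); ℂ)` is RATIONAL and
  of Hodge type `(1,1)` — hence a divisor polynomial (`casimirSum_mem_divisorClassesSpan_one`; Lefschetz `(1,1)`
  is NOT used: `divisorClassesSpan` is the span of products of rational `(1,1)`-classes). Proof: the sum does not
  depend on the basis (`sum_dual_eq_sum_dual`, the tree's Casimir lemma); in the RATIONAL basis it is a sum of cup
  products of rational classes; in a HODGE-ADAPTED basis (`exists_hodgeAdapted_basis`) the dual basis is adapted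
  with the types exchanged (`dualBasis_mem_hodgeZeroOne_of_mem`, `dualBasis_mem_hodgeOneZero_of_mem`: isotropy of
  `H^{1,0}` and `H^{0,1}`), so every summand is a `(1,0) ⌣ (0,1)` class.
* transport lemmas `congrForm_*`: non-degeneracy, invariance and isotropy of `Ψ` from the hypotheses on `ψ`.

Everything is proved; no definition, no named fact, no `sorry`; imports `Literature.*` + `HarnessLib` only.
HONEST LABEL: linear algebra; nothing here is a rung; Markman-free.

References: [cite: Deligne1982HodgeCycles, §4 (4.4)–(4.5)] (divisor classes of Weil-type abelian varieties from the
polarization and endomorphisms); [cite: Rohde2009CyclicCoverings, Ch. 6 §6.4] (the exceptional composite families);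
[cite: GoodmanWallachGTM255, §4.1.1] (Casimir element); [cite: VoisinHodgeI2002, §7.1.2, Thm. 11.30].
-/

noncomputable section

-- every declaration of this problem lives in `Summit.HodgeConjecture.HodgeConjecture.…` (summit = sub-problem)
set_option linter.dupNamespace false

open CategoryTheory Polynomial
open scoped TensorProduct
open Literature.AlgebraicGeometry Literature.AlgebraicGeometry.Motives
open Literature.AlgebraicGeometry.HodgeTheory
open Literature.AlgebraicTopology.SingularHomology

namespace Summit.HodgeConjecture.HodgeConjecture.WeilTypeLadder

/-! ### §1 Hodge-adapted bases of `H¹(B(ℂ); ℂ)` and the types of their dual bases -/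

section Hodge

variable {B : AbelianVariety ℂ}

/-- **A Hodge-adapted basis of `H¹(B(ℂ); ℂ) = H^{1,0} ⊕ H^{0,1}`**: a basis each of whose vectors lies in `H^{1,0}`
(`kind = true`) or in `H^{0,1}` (`kind = false`). [cite: VoisinHodgeI2002, §6.1.3 Cor. 6.14] -/
theorem exists_hodgeAdapted_basis (hX : IsSmoothProjective B.dim B.X) :
    ∃ (N : ℕ) (b : Module.Basis (Fin N) ℂ (complexBetti B.X 1)) (kind : Fin N → Bool),
      ∀ i, (kind i = true → b i ∈ hodgeOneZero hX) ∧ (kind i = false → b i ∈ hodgeZeroOne hX) := by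
  classical
  haveI := finite_complexBetti_abelianVariety B 1
  have hc : IsCompl (hodgeOneZero hX) (hodgeZeroOne hX) := isCompl_hodgeOneZero_hodgeZeroOne hX
  let bP := Module.finBasis ℂ (hodgeOneZero hX)
  let bQ := Module.finBasis ℂ (hodgeZeroOne hX)
  let b0 : Module.Basis (Fin (Module.finrank ℂ (hodgeOneZero hX)) ⊕ Fin (Module.finrank ℂ (hodgeZeroOne hX))) ℂ
      (complexBetti B.X 1) := (bP.prod bQ).map (Submodule.prodEquivOfIsCompl _ _ hc)
  let e := Fintype.equivFin (Fin (Module.finrank ℂ (hodgeOneZero hX)) ⊕ Fin (Module.finrank ℂ (hodgeZeroOne hX)))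
  refine ⟨_, b0.reindex e, fun i => Sum.elim (fun _ => true) (fun _ => false) (e.symm i), fun i => ?_⟩
  rw [Module.Basis.reindex_apply]
  rcases h : e.symm i with j | j
  · refine ⟨fun _ => ?_, fun h' => by simp [h] at h'⟩
    change Submodule.prodEquivOfIsCompl _ _ hc ((bP.prod bQ) (Sum.inl j)) ∈ hodgeOneZero hX
    rw [Submodule.coe_prodEquivOfIsCompl', Module.Basis.prod_apply_inl_fst, Module.Basis.prod_apply_inl_snd,
      Submodule.coe_zero, add_zero]
    exact (bP j).2
  · refine ⟨fun h' => by simp [h] at h', fun _ => ?_⟩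
    change Submodule.prodEquivOfIsCompl _ _ hc ((bP.prod bQ) (Sum.inr j)) ∈ hodgeZeroOne hX
    rw [Submodule.coe_prodEquivOfIsCompl', Module.Basis.prod_apply_inr_fst, Module.Basis.prod_apply_inr_snd,
      Submodule.coe_zero, zero_add]
    exact (bQ j).2

variable {N : ℕ}

/-- Two basis vectors of a Hodge-adapted basis of opposite types are distinct indices. [folklore] -/
theorem ne_of_mem_hodgeOneZero_of_mem_hodgeZeroOne (hX : IsSmoothProjective B.dim B.X)
    (b : Module.Basis (Fin N) ℂ (complexBetti B.X 1)) {j k : Fin N} (hj : b j ∈ hodgeOneZero hX)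
    (hk : b k ∈ hodgeZeroOne hX) : k ≠ j := by
  rintro rfl
  exact b.ne_zero k (eq_zero_of_isOfHodgeType_one_zero_of_zero_one hX hj hk)

/-- **The `Ψ`-dual basis of a Hodge-adapted basis is Hodge-adapted with the types exchanged, I**: if `Ψ` is
non-degenerate and isotropic on `H^{1,0}` and on `H^{0,1}` (first Riemann bilinear relation), and every `b_k`
lies in `H^{1,0}` or `H^{0,1}`, then `b_j ∈ H^{1,0}` forces `d_j ∈ H^{0,1}`: the `H^{1,0}`-component of `d_j` pairs
to zero with every `b_k`. [cite: VoisinHodgeI2002, §7.1.2 (first Hodge–Riemann bilinear relation)] -/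
theorem dualBasis_mem_hodgeZeroOne_of_mem (hX : IsSmoothProjective B.dim B.X)
    (Ψ : LinearMap.BilinForm ℂ (complexBetti B.X 1)) (hΨ : Ψ.Nondegenerate)
    (h10 : ∀ x ∈ hodgeOneZero hX, ∀ y ∈ hodgeOneZero hX, Ψ x y = 0)
    (h01 : ∀ x ∈ hodgeZeroOne hX, ∀ y ∈ hodgeZeroOne hX, Ψ x y = 0)
    (b : Module.Basis (Fin N) ℂ (complexBetti B.X 1)) (hb : ∀ k, b k ∈ hodgeOneZero hX ∨ b k ∈ hodgeZeroOne hX)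
    {j : Fin N} (hj : b j ∈ hodgeOneZero hX) : Ψ.dualBasis hΨ b j ∈ hodgeZeroOne hX := by
  have htop : Ψ.dualBasis hΨ b j ∈ hodgeOneZero hX ⊔ hodgeZeroOne hX := by
    rw [(isCompl_hodgeOneZero_hodgeZeroOne hX).sup_eq_top]; exact Submodule.mem_top
  obtain ⟨p, hp, q, hq, hpq⟩ := Submodule.mem_sup.1 htop
  have hp0 : p = 0 := by
    refine eq_of_forall_form_basis Ψ hΨ b fun k => ?_
    rw [map_zero, LinearMap.zero_apply]
    rcases hb k with hk | hk
    · exact h10 p hp (b k) hk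
    · have hkj := ne_of_mem_hodgeOneZero_of_mem_hodgeZeroOne hX b hj hk
      have h := LinearMap.BilinForm.apply_dualBasis_left hΨ b j k
      rw [← hpq, map_add, LinearMap.add_apply, h01 q hq (b k) hk, add_zero, if_neg hkj] at h
      exact h
  rw [← hpq, hp0, zero_add]
  exact hq

/-- **The `Ψ`-dual basis of a Hodge-adapted basis is Hodge-adapted with the types exchanged, II**: `b_j ∈ H^{0,1}`
forces `d_j ∈ H^{1,0}`. [cite: VoisinHodgeI2002, §7.1.2 (first Hodge–Riemann bilinear relation)] -/
theorem dualBasis_mem_hodgeOneZero_of_mem (hX : IsSmoothProjective B.dim B.X)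
    (Ψ : LinearMap.BilinForm ℂ (complexBetti B.X 1)) (hΨ : Ψ.Nondegenerate)
    (h10 : ∀ x ∈ hodgeOneZero hX, ∀ y ∈ hodgeOneZero hX, Ψ x y = 0)
    (h01 : ∀ x ∈ hodgeZeroOne hX, ∀ y ∈ hodgeZeroOne hX, Ψ x y = 0)
    (b : Module.Basis (Fin N) ℂ (complexBetti B.X 1)) (hb : ∀ k, b k ∈ hodgeOneZero hX ∨ b k ∈ hodgeZeroOne hX)
    {j : Fin N} (hj : b j ∈ hodgeZeroOne hX) : Ψ.dualBasis hΨ b j ∈ hodgeOneZero hX := by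
  have htop : Ψ.dualBasis hΨ b j ∈ hodgeOneZero hX ⊔ hodgeZeroOne hX := by
    rw [(isCompl_hodgeOneZero_hodgeZeroOne hX).sup_eq_top]; exact Submodule.mem_top
  obtain ⟨p, hp, q, hq, hpq⟩ := Submodule.mem_sup.1 htop
  have hq0 : q = 0 := by
    refine eq_of_forall_form_basis Ψ hΨ b fun k => ?_
    rw [map_zero, LinearMap.zero_apply]
    rcases hb k with hk | hk
    · have hkj := ne_of_mem_hodgeOneZero_of_mem_hodgeZeroOne hX b hk hj
      have h := LinearMap.BilinForm.apply_dualBasis_left hΨ b j k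
      rw [← hpq, map_add, LinearMap.add_apply, h10 p hp (b k) hk, zero_add, if_neg hkj.symm] at h
      exact h
    · exact h01 q hq (b k) hk
  rw [← hpq, hq0, add_zero]
  exact hp

/-! ### §2 The Casimir classes `Λ_b(g) = Σ_j g^* d_j ⌣ b_j` -/

/-- **Independence of the basis**: for two bases `b`, `b'` of `H¹(B(ℂ); ℂ)` with `Ψ`-dual bases `d`, `d'` and any
operator `Y`, `Σ_j Y(d_j) ⌣ b_j = Σ_j Y(d'_j) ⌣ b'_j` (the Casimir element `Σ_j d_j ⊗ b_j = Ψ⁻¹` is canonical; the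
tree's `sum_dual_eq_sum_dual`). [cite: GoodmanWallachGTM255, §4.1.1] -/
theorem casimirSum_eq_casimirSum {N N' : ℕ} (Ψ : LinearMap.BilinForm ℂ (complexBetti B.X 1)) (hΨ : Ψ.Nondegenerate)
    (b : Module.Basis (Fin N) ℂ (complexBetti B.X 1)) (b' : Module.Basis (Fin N') ℂ (complexBetti B.X 1))
    (Y : Module.End ℂ (complexBetti B.X 1)) :
    ∑ j, cupProduct (Nat.add_comm 1 1) (Y (Ψ.dualBasis hΨ b j)) (b j) =
      ∑ j, cupProduct (Nat.add_comm 1 1) (Y (Ψ.dualBasis hΨ b' j)) (b' j) := by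
  classical
  exact sum_dual_eq_sum_dual Ψ (cupProduct (Nat.add_comm 1 1)) b (Ψ.dualBasis hΨ b)
    (eq_sum_form_smul_dualBasis Ψ hΨ b) b' (Ψ.dualBasis hΨ b')
    (fun j k => LinearMap.BilinForm.apply_dualBasis_left hΨ b' j k)
    (fun y hy => eq_zero_of_forall_dualBasis_form_eq_zero Ψ hΨ b' hy) Y

/-- **In a Hodge-adapted basis every summand `g^* d_j ⌣ b_j` is of type `(1,1)`**, hence so is the Casimir class
`Λ_b(g)` (pull-backs preserve `H^{1,0}` and `H^{0,1}`; the cup product adds types).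
[cite: VoisinHodgeI2002, §7.1.2 and §7.3.2] -/
theorem casimirSum_isOfHodgeType_of_adapted (hX : IsSmoothProjective B.dim B.X)
    (Ψ : LinearMap.BilinForm ℂ (complexBetti B.X 1)) (hΨ : Ψ.Nondegenerate)
    (h10 : ∀ x ∈ hodgeOneZero hX, ∀ y ∈ hodgeOneZero hX, Ψ x y = 0)
    (h01 : ∀ x ∈ hodgeZeroOne hX, ∀ y ∈ hodgeZeroOne hX, Ψ x y = 0)
    (b : Module.Basis (Fin N) ℂ (complexBetti B.X 1)) (hb : ∀ k, b k ∈ hodgeOneZero hX ∨ b k ∈ hodgeZeroOne hX)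
    (g : B ⟶ B) :
    IsOfHodgeType B.dim B.X 2 1 1
      (∑ j, cupProduct (Nat.add_comm 1 1) (complexBetti.map g.hom.hom.hom 1 (Ψ.dualBasis hΨ b j)) (b j)) := by
  classical
  obtain ⟨M⟩ := nonempty_hodgeModel_holds.nonempty hX
  have hterm : ∀ j, IsOfHodgeType B.dim B.X 2 1 1
      (cupProduct (Nat.add_comm 1 1) (complexBetti.map g.hom.hom.hom 1 (Ψ.dualBasis hΨ b j)) (b j)) := by
    intro j
    rcases hb j with hj | hj
    · -- `b_j ∈ H^{1,0}`, `d_j ∈ H^{0,1}`, `g^* d_j ∈ H^{0,1}`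
      have hd : complexBetti.map g.hom.hom.hom 1 (Ψ.dualBasis hΨ b j) ∈ hodgeZeroOne hX :=
        map_mem_hodgeZeroOne hX g.hom.hom.hom (dualBasis_mem_hodgeZeroOne_of_mem hX Ψ hΨ h10 h01 b hb hj)
      have h := isOfHodgeType_cupPowOne hX (d := 2) two_pos
        ![complexBetti.map g.hom.hom.hom 1 (Ψ.dualBasis hΨ b j), b j] ![0, 1] ![1, 0]
        (fun i => by fin_cases i <;> assumption)
      rw [cupPowOne_two] at h
      simpa using h
    · have hd : complexBetti.map g.hom.hom.hom 1 (Ψ.dualBasis hΨ b j) ∈ hodgeOneZero hX :=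
        map_mem_hodgeOneZero hX g.hom.hom.hom (dualBasis_mem_hodgeOneZero_of_mem hX Ψ hΨ h10 h01 b hb hj)
      have h := isOfHodgeType_cupPowOne hX (d := 2) two_pos
        ![complexBetti.map g.hom.hom.hom 1 (Ψ.dualBasis hΨ b j), b j] ![1, 0] ![0, 1]
        (fun i => by fin_cases i <;> assumption)
      rw [cupPowOne_two] at h
      simpa using h
  refine Finset.sum_induction _ (fun c => IsOfHodgeType B.dim B.X 2 1 1 c) (fun a c ha hc => ha.add hX hc)
    (IsOfHodgeType.zero M 2 1 1) fun j _ => hterm j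

/-! ### §3 Transport of the `ℚ`-form `ψ` on `H¹(B(ℂ); ℚ)` to `H¹(B(ℂ); ℂ)` -/

/-- The transported form `Ψ = (ψ ⊗ ℂ) ∘ (β⁻¹ × β⁻¹)` evaluated (`β : H¹(B(ℂ); ℚ) ⊗ ℂ ≃ H¹(B(ℂ); ℂ)`).
[cite: VoisinHodgeI2002, §7.1.1] -/
theorem congrForm_apply (hX : IsSmoothProjective B.dim B.X) (ψ : LinearMap.BilinForm ℚ (bettiCohomology B.X 1))
    (x y : complexBetti B.X 1) :
    LinearMap.BilinForm.congr (ofRatClassBaseChangeEquiv hX 1) (ψ.baseChange ℂ) x y =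
      ψ.baseChange ℂ ((ofRatClassBaseChangeEquiv hX 1).symm x) ((ofRatClassBaseChangeEquiv hX 1).symm y) :=
  LinearMap.BilinForm.congr_apply _ _ x y

/-- The transported form of a non-degenerate `ℚ`-form is non-degenerate (non-degeneracy survives base change,
`nondegenerate_baseChange`, and transport along an isomorphism). [cite: VoisinHodgeI2002, §7.1.1] -/
theorem congrForm_nondegenerate (hX : IsSmoothProjective B.dim B.X) (ψ : LinearMap.BilinForm ℚ (bettiCohomology B.X 1))
    (hψ : ψ.Nondegenerate) :
    (LinearMap.BilinForm.congr (ofRatClassBaseChangeEquiv hX 1) (ψ.baseChange ℂ)).Nondegenerate := by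
  haveI := finite_bettiCohomology_one B
  exact (LinearMap.BilinForm.nondegenerate_congr_iff _).2
    (Literature.Algebra.Lie.KillingBaseChange.nondegenerate_baseChange hψ)

/-- **Invariance transports**: if `ψ(s^*x, s^*y) = ψ(x, y)` on `H¹(B(ℂ); ℚ)` for an endomorphism `s`, then
`Ψ(s^*x, s^*y) = Ψ(x, y)` on `H¹(B(ℂ); ℂ)` (`s^* ∘ β = β ∘ (s^* ⊗ ℂ)`, and two bilinear forms on `H¹ ⊗ ℂ`
agreeing on a rational basis agree). [cite: VoisinHodgeI2002, §7.1.1] -/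
theorem congrForm_map_map (hX : IsSmoothProjective B.dim B.X) (ψ : LinearMap.BilinForm ℚ (bettiCohomology B.X 1))
    (s : B ⟶ B)
    (hψs : ∀ x y : bettiCohomology B.X 1,
      ψ ((bettiCohomology.map s.hom.hom.hom 1).hom x) ((bettiCohomology.map s.hom.hom.hom 1).hom y) = ψ x y)
    (x y : complexBetti B.X 1) :
    LinearMap.BilinForm.congr (ofRatClassBaseChangeEquiv hX 1) (ψ.baseChange ℂ)
        (complexBetti.map s.hom.hom.hom 1 x) (complexBetti.map s.hom.hom.hom 1 y) =
      LinearMap.BilinForm.congr (ofRatClassBaseChangeEquiv hX 1) (ψ.baseChange ℂ) x y := by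
  classical
  set ρ := ofRatClassBaseChangeEquiv hX 1 with hρ
  set S := ((bettiCohomology.map s.hom.hom.hom 1).hom).baseChange ℂ with hS
  have hnat : ∀ z : complexBetti B.X 1, ρ.symm (complexBetti.map s.hom.hom.hom 1 z) = S (ρ.symm z) := by
    intro z
    rw [LinearEquiv.symm_apply_eq]
    conv_lhs => rw [← ρ.apply_symm_apply z]
    exact complexBetti_map_ofRatClassBaseChangeEquiv hX hX s.hom.hom.hom (ρ.symm z)
  -- the two forms `ψ_ℂ ∘ (S × S)` and `ψ_ℂ` agree on the rational basis
  let e := Module.finBasis ℚ (bettiCohomology B.X 1)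
  haveI := finite_bettiCohomology_one B
  have hforms : (ψ.baseChange ℂ).comp S S = ψ.baseChange ℂ := by
    refine LinearMap.BilinForm.ext_basis (Algebra.TensorProduct.basis ℂ e) fun i j => ?_
    rw [LinearMap.BilinForm.comp_apply, Algebra.TensorProduct.basis_apply, Algebra.TensorProduct.basis_apply, hS,
      LinearMap.baseChange_tmul, LinearMap.baseChange_tmul, LinearMap.BilinForm.baseChange_tmul,
      LinearMap.BilinForm.baseChange_tmul, hψs]
  rw [congrForm_apply, congrForm_apply, ← hρ, hnat, hnat, ← LinearMap.BilinForm.comp_apply, hforms]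

/-- **Isotropy transports**: if `ψ ⊗ ℂ` kills pairs of preimages of `(1,0)`-classes (resp. `(0,1)`-classes),
then `Ψ` is isotropic on `H^{1,0}` (resp. `H^{0,1}`). [cite: VoisinHodgeI2002, §7.1.2] -/
theorem congrForm_isotropic (hX : IsSmoothProjective B.dim B.X) (ψ : LinearMap.BilinForm ℚ (bettiCohomology B.X 1))
    (S : Submodule ℂ (complexBetti B.X 1))
    (hψS : ∀ x y : ℂ ⊗[ℚ] bettiCohomology B.X 1,
      ofRatClassBaseChange (Motives.ComplexPoints B.X) 1 x ∈ S →
        ofRatClassBaseChange (Motives.ComplexPoints B.X) 1 y ∈ S → ψ.baseChange ℂ x y = 0) :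
    ∀ x ∈ S, ∀ y ∈ S, LinearMap.BilinForm.congr (ofRatClassBaseChangeEquiv hX 1) (ψ.baseChange ℂ) x y = 0 := by
  intro x hx y hy
  rw [congrForm_apply]
  refine hψS _ _ ?_ ?_
  · rw [← ofRatClassBaseChangeEquiv_apply hX, LinearEquiv.apply_symm_apply]; exact hx
  · rw [← ofRatClassBaseChangeEquiv_apply hX, LinearEquiv.apply_symm_apply]; exact hy

/-- **The Casimir class is RATIONAL for `Y = g^*`**: computed in the rational basis `β(1 ⊗ e_i)` of `H¹(B(ℂ); ℂ)`,
whose `Ψ`-dual basis is `β(1 ⊗ d_i)` for the `ψ`-dual basis `d` of `e`, it is a sum of cup products of rational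
classes. [cite: HatcherAT2002, §3.1 p. 198 and §3.2] [cite: GoodmanWallachGTM255, §4.1.1] -/
theorem casimirSum_isRationalClass (hX : IsSmoothProjective B.dim B.X)
    (ψ : LinearMap.BilinForm ℚ (bettiCohomology B.X 1)) (hψ : ψ.Nondegenerate)
    (Ψ : LinearMap.BilinForm ℂ (complexBetti B.X 1))
    (hΨψ : Ψ = LinearMap.BilinForm.congr (ofRatClassBaseChangeEquiv hX 1) (ψ.baseChange ℂ))
    (hΨ : Ψ.Nondegenerate) (b : Module.Basis (Fin N) ℂ (complexBetti B.X 1)) (g : B ⟶ B) :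
    IsRationalClass
      (∑ j, cupProduct (Nat.add_comm 1 1) (complexBetti.map g.hom.hom.hom 1 (Ψ.dualBasis hΨ b j)) (b j)) := by
  classical
  haveI := finite_bettiCohomology_one B
  set ρ := ofRatClassBaseChangeEquiv hX 1 with hρ
  let e := Module.finBasis ℚ (bettiCohomology B.X 1)
  let d := ψ.dualBasis hψ e
  -- the rational basis of `H¹(B(ℂ); ℂ)` and its dual family
  let E : Module.Basis (Fin _) ℂ (complexBetti B.X 1) := (Algebra.TensorProduct.basis ℂ e).map ρ
  let D : Module.Basis (Fin _) ℂ (complexBetti B.X 1) := (Algebra.TensorProduct.basis ℂ d).map ρ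
  have hE : ∀ i, E i = ofRatClass (Motives.ComplexPoints B.X) 1 (e i) := fun i => by
    change ρ (Algebra.TensorProduct.basis ℂ e i) = _
    rw [Algebra.TensorProduct.basis_apply, hρ, ofRatClassBaseChangeEquiv_apply, ofRatClassBaseChange_tmul, one_smul]
  have hD : ∀ i, D i = ofRatClass (Motives.ComplexPoints B.X) 1 (d i) := fun i => by
    change ρ (Algebra.TensorProduct.basis ℂ d i) = _
    rw [Algebra.TensorProduct.basis_apply, hρ, ofRatClassBaseChangeEquiv_apply, ofRatClassBaseChange_tmul, one_smul]
  have hdual : ∀ i k, Ψ (D i) (E k) = if k = i then 1 else 0 := by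
    intro i k
    rw [hΨψ, congrForm_apply, ← hρ]
    change ψ.baseChange ℂ (ρ.symm (ρ (Algebra.TensorProduct.basis ℂ d i)))
      (ρ.symm (ρ (Algebra.TensorProduct.basis ℂ e k))) = _
    rw [LinearEquiv.symm_apply_apply, LinearEquiv.symm_apply_apply, Algebra.TensorProduct.basis_apply,
      Algebra.TensorProduct.basis_apply, LinearMap.BilinForm.baseChange_tmul, mul_one,
      LinearMap.BilinForm.apply_dualBasis_left hψ e i k]
    split_ifs <;> simp
  have hsep : ∀ y, (∀ i, Ψ (D i) y = 0) → y = 0 := fun y hy =>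
    eq_zero_of_forall_form_eq_zero_of_dual Ψ E D hdual hy
  have hswap := sum_dual_eq_sum_dual Ψ (cupProduct (Nat.add_comm 1 1)) b (Ψ.dualBasis hΨ b)
    (eq_sum_form_smul_dualBasis Ψ hΨ b) E D hdual hsep (complexBetti.map g.hom.hom.hom 1).hom
  change IsRationalClass (∑ j, cupProduct (Nat.add_comm 1 1)
    ((complexBetti.map g.hom.hom.hom 1).hom (Ψ.dualBasis hΨ b j)) (b j))
  rw [hswap]
  refine isRationalClass_sum _ _ fun i _ => ?_
  rw [hD, hE]
  exact ((isRationalClass_ofRatClass _).pullback _).cup _ (isRationalClass_ofRatClass _)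

/-- **The Casimir class of an endomorphism is a rational `(1,1)`-class**, for EVERY basis `b` of `H¹(B(ℂ); ℂ)`:
rational by `casimirSum_isRationalClass`, of type `(1,1)` by transport to a Hodge-adapted basis
(`casimirSum_eq_casimirSum`, `casimirSum_isOfHodgeType_of_adapted`). Hypotheses on `ψ`: non-degenerate, and
`ψ ⊗ ℂ` isotropic on `H^{1,0}` and on `H^{0,1}` (first Riemann bilinear relation of a polarization).
[cite: Deligne1982HodgeCycles, §4 (4.4)–(4.5)] [cite: VoisinHodgeI2002, §7.1.2] -/
theorem casimirSum_isRationalClass_and_isOfHodgeType (hX : IsSmoothProjective B.dim B.X)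
    (ψ : LinearMap.BilinForm ℚ (bettiCohomology B.X 1)) (hψ : ψ.Nondegenerate)
    (hψ10 : ∀ x y : ℂ ⊗[ℚ] bettiCohomology B.X 1,
      ofRatClassBaseChange (Motives.ComplexPoints B.X) 1 x ∈ hodgeOneZero hX →
        ofRatClassBaseChange (Motives.ComplexPoints B.X) 1 y ∈ hodgeOneZero hX → ψ.baseChange ℂ x y = 0)
    (hψ01 : ∀ x y : ℂ ⊗[ℚ] bettiCohomology B.X 1,
      ofRatClassBaseChange (Motives.ComplexPoints B.X) 1 x ∈ hodgeZeroOne hX →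
        ofRatClassBaseChange (Motives.ComplexPoints B.X) 1 y ∈ hodgeZeroOne hX → ψ.baseChange ℂ x y = 0)
    (Ψ : LinearMap.BilinForm ℂ (complexBetti B.X 1))
    (hΨψ : Ψ = LinearMap.BilinForm.congr (ofRatClassBaseChangeEquiv hX 1) (ψ.baseChange ℂ))
    (hΨ : Ψ.Nondegenerate) (b : Module.Basis (Fin N) ℂ (complexBetti B.X 1)) (g : B ⟶ B) :
    IsRationalClass
        (∑ j, cupProduct (Nat.add_comm 1 1) (complexBetti.map g.hom.hom.hom 1 (Ψ.dualBasis hΨ b j)) (b j)) ∧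
      IsOfHodgeType B.dim B.X 2 1 1
        (∑ j, cupProduct (Nat.add_comm 1 1) (complexBetti.map g.hom.hom.hom 1 (Ψ.dualBasis hΨ b j)) (b j)) := by
  refine ⟨casimirSum_isRationalClass hX ψ hψ Ψ hΨψ hΨ b g, ?_⟩
  obtain ⟨N', b', kind, hb'⟩ := exists_hodgeAdapted_basis (B := B) hX
  have hb'' : ∀ k, b' k ∈ hodgeOneZero hX ∨ b' k ∈ hodgeZeroOne hX := fun k => by
    cases hk : kind k
    · exact Or.inr ((hb' k).2 hk)
    · exact Or.inl ((hb' k).1 hk)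
  have h10 : ∀ x ∈ hodgeOneZero hX, ∀ y ∈ hodgeOneZero hX, Ψ x y = 0 := by
    rw [hΨψ]; exact congrForm_isotropic hX ψ _ hψ10
  have h01 : ∀ x ∈ hodgeZeroOne hX, ∀ y ∈ hodgeZeroOne hX, Ψ x y = 0 := by
    rw [hΨψ]; exact congrForm_isotropic hX ψ _ hψ01
  have hswap := casimirSum_eq_casimirSum Ψ hΨ b b' (complexBetti.map g.hom.hom.hom 1).hom
  change IsOfHodgeType B.dim B.X 2 1 1 (∑ j, cupProduct (Nat.add_comm 1 1)
    ((complexBetti.map g.hom.hom.hom 1).hom (Ψ.dualBasis hΨ b j)) (b j))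
  rw [hswap]
  exact casimirSum_isOfHodgeType_of_adapted hX Ψ hΨ h10 h01 b' hb'' g

/-- **Corollary: the Casimir class is a divisor polynomial** — it lies in `divisorClassesSpan B.X B.dim 1`, the
complex span of the rational `(1,1)`-classes. [cite: vanGeemen1994HodgeAV, §2.4] -/
theorem casimirSum_mem_divisorClassesSpan_one (hX : IsSmoothProjective B.dim B.X)
    (ψ : LinearMap.BilinForm ℚ (bettiCohomology B.X 1)) (hψ : ψ.Nondegenerate)
    (hψ10 : ∀ x y : ℂ ⊗[ℚ] bettiCohomology B.X 1,
      ofRatClassBaseChange (Motives.ComplexPoints B.X) 1 x ∈ hodgeOneZero hX →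
        ofRatClassBaseChange (Motives.ComplexPoints B.X) 1 y ∈ hodgeOneZero hX → ψ.baseChange ℂ x y = 0)
    (hψ01 : ∀ x y : ℂ ⊗[ℚ] bettiCohomology B.X 1,
      ofRatClassBaseChange (Motives.ComplexPoints B.X) 1 x ∈ hodgeZeroOne hX →
        ofRatClassBaseChange (Motives.ComplexPoints B.X) 1 y ∈ hodgeZeroOne hX → ψ.baseChange ℂ x y = 0)
    (Ψ : LinearMap.BilinForm ℂ (complexBetti B.X 1))
    (hΨψ : Ψ = LinearMap.BilinForm.congr (ofRatClassBaseChangeEquiv hX 1) (ψ.baseChange ℂ))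
    (hΨ : Ψ.Nondegenerate) (b : Module.Basis (Fin N) ℂ (complexBetti B.X 1)) (g : B ⟶ B) :
    (∑ j, cupProduct (Nat.add_comm 1 1) (complexBetti.map g.hom.hom.hom 1 (Ψ.dualBasis hΨ b j)) (b j)) ∈
      Literature.Barriers.HodgeConjecture.divisorClassesSpan B.X B.dim 1 := by
  obtain ⟨hQ, hH⟩ := casimirSum_isRationalClass_and_isOfHodgeType hX ψ hψ hψ10 hψ01 Ψ hΨψ hΨ b g
  exact mem_divisorClassesSpan_one hQ hH

end Hodge

end Summit.HodgeConjecture.HodgeConjecture.WeilTypeLadder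

end
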